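import Literature.MathematicalPhysics.QuantumFieldTheory.Balaban1983to89.Node00.CarriersB6KLeaves
import Literature.MathematicalPhysics.QuantumFieldTheory.Balaban1983to89.B6Lemma21ParamKLevelTorus
import Literature.MathematicalPhysics.QuantumFieldTheory.Balaban1983to89.B6Prop25TwoScaleCensus
import Literature.MathematicalPhysics.QuantumFieldTheory.Balaban1983to89.B6BlockParamOneLevel
import Literature.MathematicalPhysics.QuantumFieldTheory.Balaban1983to89.B6KLevelFamilyWitnessV1
import HarnessLib

/-!
# NODE 00 (YM-PLAN Track A) — STAGE 3, THE DISCHARGES: four of the five displayed inputs of `Node00.b6BlockParam_tower_of` PROVED on the k-level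
# tower block of record — Lemma 2.1 in parameter form (`h21`), Proposition 2.2 (`h22`), Lemma 2.4 (`h24`, at the tree-gauge carriers of record) and
# Proposition 2.5 (`h25`, at the genuine two-scale local operators of record) — so that the DAG leaf `b6` of [Balaban1984PropagatorsII] on
# `towerBlockOfRecord` (T. Bałaban, *Propagators and renormalization transformations for lattice gauge theories. II*, Commun. Math. Phys. **96** (1984)
# 223–250, Lemma 2.1 – Cor. 2.8 pp. 234–249) is REDUCED TO ITS PROPOSITION 2.6 CENSUS ALONE: `b6BlockParam_tower_of_prop26 (h26)`

Cell pub-ymgap, seat `pub-ymgap-dag-p1` (prover; Track-A node N03 = [B6]; OPS-REQUESTS l.313; director-ym LINE №5 (C)(4) ∕ №6; lead R415∕R416), the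
companion of node00-def g27's `Node00.CarriersB6K` (definitions) ∕ `Node00.CarriersB6KLeaves` (Props. 2.3, 2.7, Cor. 2.8 by name + the knit
`b6BlockParam_tower_of (h21) (h22) (h24) (h25) (h26)`).  THEOREMS ONLY; no `def`; no landed module edited; every estimate is a tree theorem cited BY NAME:
`B6Lemma21ParamKLevelTorus.lemma21Param_kLevelTorusP` (this seat, p403382), `B6Prop27KLevelV1.card_fiber_beta_le` (r03), `B6Prop22KLevelTorusCensusEta.prop22Printed_kLevelTorusP`
(p21), `B6Lemma24Printed.lemma24Printed_carrier` (b06), `B6Prop25TwoScaleCensus.prop25Printed_TS` (r03∕p22∕p38), `B6KLevelFamilyWitnessV1` (r03).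

HONEST FRAMING (programme rule): statement-level skeleton of published theorems with citation tags; proofs where landed; nothing here is a claim
about the Yang–Mills mass gap.  One finite T⁴ programme; a Literature landing is NOT a node discharge (NODE 00's `carriers₃` pin + venue proof + referee
co-sign, YM-PLAN §1); typed 28∕28 · discharged 0∕28 unmoved; nothing continuum ∕ infinite-volume ∕ OS ∕ mass-gap ∕ Clay.

## WHAT IS PRINTED (locators; verbatim texts are the docstrings of `B6.Lemma21Printed`, `B6.Prop22Printed`, `B6.Lemma24Printed`, `B6.Prop25Printed`)

Lemma 2.1 (2.60)–(2.61) p. 234 under (2.59) p. 233; Proposition 2.2 (2.67) p. 234; Lemma 2.4 (2.128) p. 245; Proposition 2.5 p. 246 ((2.129) + [4] Prop. 1.2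
(1.110)–(1.114) with δ₂); and the frame (2.1)–(2.4) p. 224, (2.45)–(2.46) p. 231, p. 248 «sites replaced by bonds».

## WHAT THIS FILE PROVES (0 sorry; standard axioms)

* §1 `lenTP_rpow_beta`-free bookkeeping: **`prop22_tower (hℓ : 1 ≤ ℓ) : B6.Prop22Printed (kGeoU ∘ val) (GpU ∘ val)`** — BOTH conjuncts of (2.67) VERBATIM
  from p21's torus census `prop22Printed_kLevelTorusP` along `toKT`, read at the carrier blocks (`lenTP_beta_eq`, `MTP_eq`); the site-kind cut-offs and
  Hölder slot of `kGeoU`∕`GpU` ARE the census ones at `β c`, so no site-vs-bond comparison is needed; on the fine-bond summand the functionals are `0 ≤ C·(…)`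
  (constant `C(α) ↦ max (C(α), 0)`).
* §2 **`lemma21Param_tower (hℓ) (hδ₀ : 0 < δ₀) (hδL : δ₀ ≤ 2/(ℓ+1)) (tree) (loc) : DagBinding.B6Lemma21Param (towerBlockOfRecord d ℓ hd hL b₀ b₁ δ₀ tree loc)`**
  — (2.60) verbatim for `kGeoU` (`R`-field `R − 1`, scale of a bond = level of its carrier block) and (2.61) pulled back along `β` with the fibre factor
  `2(d+1)` (`card_fiber_beta_le`): `c₁(α) := 2(d+1)·c₁^T(α)`, from `lemma21Param_kLevelTorusP` on the member's torus family.
* §3 the carriers of record for the two index-free conjuncts, stated inline (no definition): Lemma 2.4's tree-gauge data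
  `fun t : TreeIdx (d+1) (ℓ+1) => carrier (ℓ+1) t.1 (q1Of (ℓ+1) t.1)` (every finite `Λ′ ⊂ Lℤ^{d+1}`; `lemma24_towerTrees` = `lemma24Printed_carrier`, THE
  PRINTED constant `1/(12d²)`, `d + 1 ≥ 2`) and Prop. 2.5's genuine two-scale local operators `fun t : TSIdx d (ℓ+1) hd hL b₀ b₁ => t.locTS` (`prop25Printed_TS`).
* §4 **`b6BlockParam_tower_of_prop26 (hd1 : 1 ≤ d) (hℓ : 1 ≤ ℓ) (hb₀ : 0 < b₀) (hb₁ : b₀ ≤ b₁) (hδ₀ : 0 < δ₀) (hδL : δ₀ ≤ 2/(ℓ+1))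
  (h26 : B6.Prop26Printed kGeoG kG) : DagBinding.B6BlockParam (towerBlockOfRecord d ℓ hd hL b₀ b₁ δ₀ ⟨trees of record⟩ ⟨loc of record⟩)`** — the leaf
  modulo EXACTLY r03's Prop. 2.6 census (`B6Prop26PrintedStage2KLevelV1.prop26Printed_kLevel_of_slots5`: slots hm2, hl3, hl4, hl5, c3, c4);
  `mainResults_tower_of_prop26`; `b6BlockParam_tower_iff` (at the carriers of record the leaf ↔ its Prop. 2.6 conjunct on `kGeoU`);
  `kRIdx_nonvacuous_L5` (the index of record is inhabited at `L = 5` beyond every threshold, weights rescaled to `c_f = 5^k`).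

## HONEST SCOPE ∕ NOT CLAIMED

Exactly the scopes of the inputs: the V1 torus family in print's units (`KRIdx`), `k ≥ 2`, odd `L = ℓ + 1 ≥ 5` (placement supplied by the member; non-vacuity
shown at `L = 5`), `M_h = Lᵃ ≥ 8`, `R ≥ 2L²`, weights in the band; distance `d_T`; constants OURS; (2.60) with the geometry's `R`-field `R − 1`
(`B6Lemma21ParamKLevelTorus`); `δ₀ ≤ 2/L` (the leaf's Lemma-2.1 rate is free in `B6.BlockData`; chosen so that print's (2.59) implies the summability threshold
of the torus Lemma 2.1 for every α).  `B6BlockParam (towerBlockOfRecord …)` is NOT claimed outright — its Prop. 2.6 conjunct is the displayed census `h26`.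
`B6.StatedBlock` (the literal `c₁(α)`) is not claimed (refuted as typed).  NOT summit progress.  Seat `pub-ymgap-dag-p1`, 2026-08-25.
-/

noncomputable section

namespace Literature.MathematicalPhysics.QuantumFieldTheory.Balaban1983to89.Node00

open LatticeFieldCalculus
open B6 (Prop22Printed Lemma24Printed Prop25Printed Prop26Printed pref4)
open B6SectAOperatorsV1 (BondIdx)
open B6MultiLevelBoxOperator (N0)
open B6MultiLevelTorusOperator (TDomains)
open B6GlobalChartV1 (PV domT blkV1)
open B6Geom246MultiLevelTorus (geomT)
open B6Ineq2142KLevelV1 (lvl β beta_level)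
open B6CubeWindowV1 (Placed GlobalBand)
open B6Cover236MultiLevelBlocks (cubes)
open B6KLevelCensusIndexV1 (KIdx kGeo kGeoG)
open B6Prop22KLevelTorusCensus (KTIdx)
open B6Prop22KLevelTorusCensusEta (geoTP gpTP nKT hqTP_nonneg prop22Printed_kLevelTorusP)
open B6Prop26Census2136KLevelV1 (kG)
open B6Prop26PrintedKLevelV1 (pref4_nonneg)
open B6Prop27KLevelV1 (card_fiber_beta_le)
open B6Prop25TwoScaleCensus (TSIdx prop25Printed_TS)
open B6BlockParamOneLevel (TreeIdx)
open B6Lemma24Carrier (carrier q1Of)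
open B6Lemma24Printed (lemma24Printed_carrier)
open B6Lemma21Repaired (Ineq261With)
open B6Lemma21ParamKLevelTorus (lemma21Param_kLevelTorusP)
open B6KLevelFamilyWitnessV1 (kLevelFamily_nonvacuous_L5)
open DagBinding (B6Lemma21Param B6BlockParam b6BlockParam_mainResults)

variable {d ℓ : ℕ} {hd : 1 ≤ d + 1} {hL : Odd (ℓ + 1) ∧ 1 < ℓ + 1} {b₀ b₁ : ℝ}

/-! ## §1  Proposition 2.2 on the tower geometry (`h22`) -/

/-- `1 ≤ k` for a member of the index of record. [cite: Balaban1984PropagatorsII, (2.1) p.224, bookkeeping] -/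
theorem KRIdx.one_le_k (i : KRIdx d ℓ hd hL b₀ b₁) : 1 ≤ i.1.k := le_trans one_le_two i.1.hk2

/-- **PROPOSITION 2.2 (2.67), BOTH CONJUNCTS VERBATIM, ON THE TOWER GEOMETRY** (`h22` of `b6BlockParam_tower_of`) — from p21's torus census
`prop22Printed_kLevelTorusP` (member `toKT i`, output block `βb`, input block `βb′`; same lengths `lenTP_beta_eq`, same threshold `MTP_eq`, same torus
distance; the site-kind supports ∕ cut-offs ∕ Hölder slot of `kGeoU`∕`GpU` are the census ones at the carrier block); on the fine-bond summand the
functionals vanish and the right-hand sides are nonnegative with `C(α) ↦ max (C(α), 0)`. [cite: Balaban1984PropagatorsII, Prop. 2.2 (2.67) p.234] -/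
theorem prop22_tower (hℓ : 1 ≤ ℓ) : Prop22Printed (fun i : KRIdx d ℓ hd hL b₀ b₁ => kGeoU i.1) (fun i => GpU i.1) := by
  obtain ⟨M₁, δ₀, C, Cα, hM₁, hδ₀, hC, h⟩ := prop22Printed_kLevelTorusP d ℓ hℓ
  refine ⟨M₁, δ₀, C, fun α => max (Cα α) 0, hM₁, hδ₀, hC, fun i _ hM => ?_⟩
  have hM' : M₁ ≤ (geoTP (toKT i.1)).M := by rw [MTP_eq]; exact hM
  obtain ⟨h1, h2⟩ := h (toKT i.1) trivial hM'
  have hlen : ∀ b : (kGeoU i.1).Site, 0 ≤ (kGeoU i.1).len b := fun b => by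
    rw [lenU_eq]; exact (B6KLevelCensusIndexV1.len_pos i.1 b).le
  refine ⟨fun n lam b b' hsupp => ?_, fun α lam ζ b b' hα0 hα1 hcut hsupp => ?_⟩
  · rcases lam with f | J
    · have := h1 n f (β i.1.hN i.1.D i.1.hk b) (β i.1.hN i.1.D i.1.hk b') hsupp
      rw [lenTP_beta_eq] at this; exact this
    · exact mul_nonneg (mul_nonneg (mul_nonneg hC.le (pref4_nonneg (hlen b) n)) (Real.exp_pos _).le) (supNormU_nonneg i.1 _)
  · have hfac : 0 ≤ max (Cα α) 0 * ((kGeoU i.1).len b) ^ (1 - α) * (kGeoU i.1).cutH α ζ *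
        Real.exp (-(δ₀ / 2 * (kGeoU i.1).dist b b')) * (kGeoU i.1).supNorm lam :=
      mul_nonneg (mul_nonneg (mul_nonneg (mul_nonneg (le_max_right _ _) (Real.rpow_nonneg (hlen b) _))
        (cutHU_nonneg i.1 α ζ)) (Real.exp_pos _).le) (supNormU_nonneg i.1 lam)
    rcases lam with f | J
    · rcases ζ with z | z
      · have := h2 α f z (β i.1.hN i.1.D i.1.hk b) (β i.1.hN i.1.D i.1.hk b') hα0 hα1 hcut hsupp
        rw [lenTP_beta_eq] at this
        refine this.trans ?_
        have hrest : 0 ≤ ((kGeoU i.1).len b) ^ (1 - α) * (geoTP (toKT i.1)).cutH α z *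
            Real.exp (-(δ₀ / 2 * (geoTP (toKT i.1)).dist (β i.1.hN i.1.D i.1.hk b) (β i.1.hN i.1.D i.1.hk b'))) *
            (geoTP (toKT i.1)).supNorm f :=
          mul_nonneg (mul_nonneg (mul_nonneg (Real.rpow_nonneg (hlen b) _) (cutH_site_nonneg i.1 α z))
            (Real.exp_pos _).le) (supNormU_nonneg i.1 (Sum.inl f))
        have e1 : ∀ K : ℝ, K * ((kGeoU i.1).len b) ^ (1 - α) * (geoTP (toKT i.1)).cutH α z *
            Real.exp (-(δ₀ / 2 * (geoTP (toKT i.1)).dist (β i.1.hN i.1.D i.1.hk b) (β i.1.hN i.1.D i.1.hk b'))) *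
            (geoTP (toKT i.1)).supNorm f = K * (((kGeoU i.1).len b) ^ (1 - α) * (geoTP (toKT i.1)).cutH α z *
            Real.exp (-(δ₀ / 2 * (geoTP (toKT i.1)).dist (β i.1.hN i.1.D i.1.hk b) (β i.1.hN i.1.D i.1.hk b'))) *
            (geoTP (toKT i.1)).supNorm f) := fun K => by ring
        have key := mul_le_mul_of_nonneg_right (le_max_left (Cα α) 0) hrest
        rw [← e1, ← e1] at key
        exact key
      · exact hfac
    · exact hfac

/-! ## §2  Lemma 2.1 in parameter form on the tower block (`h21`) -/

/-- **LEMMA 2.1 IN PARAMETER FORM (`DagBinding.B6Lemma21Param`) ON THE TOWER BLOCK OF RECORD** (`h21` of `b6BlockParam_tower_of`; `L = ℓ + 1 ≥ 2`,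
`0 < δ₀ ≤ 2/L`, any `tree`, `loc`): from `B6Lemma21ParamKLevelTorus.lemma21Param_kLevelTorusP` on the member's torus family `toKT i` — (2.60) verbatim for
`kGeoU` (whose `R`-field is `R − 1` and whose scale of a bond is the level of its carrier block, `beta_level`), (2.61) pulled back along `β` with the fibre
factor `2(d+1)` (`card_fiber_beta_le`): `c₁(α) := 2(d+1)·c₁^T(α)`, uniform over the family. [cite: Balaban1984PropagatorsII, Lemma 2.1 (2.60)–(2.61) p.234, (2.59) p.233] -/
theorem lemma21Param_tower (hℓ : 1 ≤ ℓ) {δ₀ : ℝ} (hδ₀ : 0 < δ₀) (hδL : δ₀ ≤ 2 / ((ℓ : ℝ) + 1)) {Jt Kt : Type}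
    (tree : Jt → B6.TreeData) (loc : Kt → B6.LocalOp) :
    B6Lemma21Param (towerBlockOfRecord d ℓ hd hL b₀ b₁ δ₀ tree loc) := by
  classical
  obtain ⟨c₁, -, h⟩ := lemma21Param_kLevelTorusP d ℓ hℓ hδ₀ hδL
  refine ⟨fun α => 2 * ((d : ℝ) + 1) * c₁ α, fun i _ α hα0 hα1 h259 => ?_⟩
  have h259' : B6.Cond259 (d + 1) δ₀ α ((geoTP (toKT i.1)).R - 1) (geoTP (toKT i.1)).M := by
    rw [MTP_eq]; exact h259
  obtain ⟨h260, h261⟩ := h (toKT i.1) trivial α hα0 hα1 h259'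
  refine ⟨fun b b' => ?_, fun b => ?_⟩
  · -- (2.60): scale of a bond = level of its carrier block; same `R − 1`, same `M`
    have := h260 (β i.1.hN i.1.D i.1.hk b) (β i.1.hN i.1.D i.1.hk b')
    have hs : ∀ c : (kGeoU i.1).Site, (((kGeoU i.1).scale c : ℕ) : ℝ) = ((geoTP (toKT i.1)).scale (β i.1.hN i.1.D i.1.hk c) : ℝ) :=
      fun c => by
        show ((lvl i.1.hN i.1.D i.1.hk c : ℕ) : ℝ) = (((β i.1.hN i.1.D i.1.hk c).1.1 : ℕ) : ℝ)
        rw [beta_level i.1.hN i.1.D i.1.hk (KRIdx.one_le_k i)]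
    show Real.exp (-(α * δ₀ * (kGeoU i.1).dist b b')) ≤
      Real.exp (-(α * δ₀ * (kGeoU i.1).R * (kGeoU i.1).M * max (|((kGeoU i.1).scale b : ℝ) - (kGeoU i.1).scale b'| - 1) 0))
    rw [hs b, hs b', ← MTP_eq]
    exact this
  · -- (2.61): sum over index bonds = sum over carrier blocks weighted by the fibre cardinalities ≤ 2(d+1)
    show ∑ b', Real.exp (-(α * δ₀ * (kGeoU i.1).dist b b')) ≤ 2 * ((d : ℝ) + 1) * c₁ α
    set g : (geoTP (toKT i.1)).Site → ℝ :=
      fun y' => Real.exp (-(α * δ₀ * (geoTP (toKT i.1)).dist (β i.1.hN i.1.D i.1.hk b) y')) with hg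
    have hg0 : ∀ y', 0 ≤ g y' := fun y' => (Real.exp_pos _).le
    have h1 : ∑ b', Real.exp (-(α * δ₀ * (kGeoU i.1).dist b b')) =
        ∑ b' : BondIdx (domT i.1.hN i.1.D i.1.hk), g (β i.1.hN i.1.D i.1.hk b') := rfl
    rw [h1, Finset.sum_comp]
    have hrow : ∑ y', g y' ≤ c₁ α := h261 (β i.1.hN i.1.D i.1.hk b)
    calc ∑ y' ∈ Finset.univ.image (β i.1.hN i.1.D i.1.hk),
          (Finset.univ.filter fun b' => β i.1.hN i.1.D i.1.hk b' = y').card • g y'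
        ≤ ∑ y' ∈ Finset.univ.image (β i.1.hN i.1.D i.1.hk), (2 * ((d : ℝ) + 1)) * g y' :=
          Finset.sum_le_sum fun y' _ => by
            rw [nsmul_eq_mul]
            refine mul_le_mul_of_nonneg_right ?_ (hg0 y')
            exact_mod_cast card_fiber_beta_le i.1.hN i.1.D i.1.hk (KRIdx.one_le_k i) y'
      _ ≤ ∑ y', (2 * ((d : ℝ) + 1)) * g y' :=
          Finset.sum_le_sum_of_subset_of_nonneg (Finset.subset_univ _) fun y' _ _ => by positivity
      _ = 2 * ((d : ℝ) + 1) * ∑ y', g y' := by rw [Finset.mul_sum]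
      _ ≤ 2 * ((d : ℝ) + 1) * c₁ α := mul_le_mul_of_nonneg_left hrow (by positivity)

/-! ## §3  The index-free conjuncts at the carriers of record (`h24`, `h25`) -/

/-- **LEMMA 2.4 (2.128) WITH THE PRINTED CONSTANT `1/(12d²)` AT THE TREE-GAUGE CARRIERS OF RECORD** — every finite `Λ′ ⊂ Lℤ^{d+1}` (index
`B6BlockParamOneLevel.TreeIdx (d+1) (ℓ+1)`, carriers `B6Lemma24Carrier.carrier`), by b06's `lemma24Printed_carrier` (`d + 1 ≥ 2`, every `L ≥ 1`); the
`h24` of `b6BlockParam_tower_of` at `tree :=` these carriers. [cite: Balaban1984PropagatorsII, Lemma 2.4 (2.128) p.245] -/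
theorem lemma24_towerTrees (hd1 : 1 ≤ d) :
    Lemma24Printed (d + 1) (((ℓ + 1 : ℕ) : ℝ)) (fun t : TreeIdx (d + 1) (ℓ + 1) => carrier (ℓ + 1) t.1 (q1Of (ℓ + 1) t.1)) :=
  lemma24Printed_carrier (d := d + 1) (L := ℓ + 1) (by omega) (by omega) (fun t : TreeIdx (d + 1) (ℓ + 1) => t.1) fun t => t.2

/-! ## §4  The leaf on the tower block of record, modulo the Prop. 2.6 census -/

/-- **THE DAG LEAF `b6` IN PARAMETER FORM ON THE k-LEVEL TOWER BLOCK OF RECORD, MODULO EXACTLY THE PROP. 2.6 CENSUS**: for print's dimension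
`d + 1 ≥ 2`, odd `L = ℓ + 1` (`ℓ ≥ 1`), band `0 < b₀ ≤ b₁`, rate `0 < δ₀ ≤ 2/L`, with Lemma 2.4's tree-gauge carriers and Prop. 2.5's genuine two-scale
local operators of record: `h26 : B6.Prop26Printed (kGeoG) (kG)` (the conclusion of r03's `prop26Printed_kLevel_of_slots5`) ⟹
`DagBinding.B6BlockParam (towerBlockOfRecord …)` — `b6BlockParam_tower_of` with `h21 := lemma21Param_tower`, `h22 := prop22_tower`,
`h24 := lemma24_towerTrees`, `h25 := prop25Printed_TS`. [cite: Balaban1984PropagatorsII, pp.223–250 (Lemma 2.1 p.234, Prop. 2.2 p.234, Prop. 2.3 p.238, Lemma 2.4 p.245, Prop. 2.5 p.246, Prop. 2.6 p.247, Prop. 2.7 p.249, Cor. 2.8 p.249)] -/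
theorem b6BlockParam_tower_of_prop26 (hd1 : 1 ≤ d) (hℓ : 1 ≤ ℓ) (hb₀ : 0 < b₀) (hb₁ : b₀ ≤ b₁) {δ₀ : ℝ} (hδ₀ : 0 < δ₀)
    (hδL : δ₀ ≤ 2 / ((ℓ : ℝ) + 1)) (h26 : Prop26Printed (fun i : KIdx d ℓ hd hL b₀ b₁ => kGeoG i) (fun i => kG i)) :
    B6BlockParam (towerBlockOfRecord d ℓ hd hL b₀ b₁ δ₀
      (fun t : TreeIdx (d + 1) (ℓ + 1) => carrier (ℓ + 1) t.1 (q1Of (ℓ + 1) t.1))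
      (fun t : TSIdx d (ℓ + 1) hd hL b₀ b₁ => t.locTS)) :=
  b6BlockParam_tower_of d ℓ hd hL b₀ b₁ hℓ hb₀ hb₁ δ₀ _ _ (lemma21Param_tower hℓ hδ₀ hδL _ _) (prop22_tower hℓ)
    (lemma24_towerTrees hd1) (prop25Printed_TS (d := d) (L := ℓ + 1) (hd := hd) (hL := hL) hb₀ hb₁) h26

/-- the «main technical results» (Prop. 2.6 ∧ Cor. 2.8, p. 249) on the tower block of record, modulo the census, through the DAG's projection.
[cite: Balaban1984PropagatorsII, p.249] -/
theorem mainResults_tower_of_prop26 (hd1 : 1 ≤ d) (hℓ : 1 ≤ ℓ) (hb₀ : 0 < b₀) (hb₁ : b₀ ≤ b₁) {δ₀ : ℝ} (hδ₀ : 0 < δ₀)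
    (hδL : δ₀ ≤ 2 / ((ℓ : ℝ) + 1)) (h26 : Prop26Printed (fun i : KIdx d ℓ hd hL b₀ b₁ => kGeoG i) (fun i => kG i)) :
    B6.MainResults (towerBlockOfRecord d ℓ hd hL b₀ b₁ δ₀
      (fun t : TreeIdx (d + 1) (ℓ + 1) => carrier (ℓ + 1) t.1 (q1Of (ℓ + 1) t.1))
      (fun t : TSIdx d (ℓ + 1) hd hL b₀ b₁ => t.locTS)) :=
  b6BlockParam_mainResults _ (b6BlockParam_tower_of_prop26 hd1 hℓ hb₀ hb₁ hδ₀ hδL h26)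

/-- **AT THE CARRIERS OF RECORD THE LEAF REDUCES TO ITS PROPOSITION 2.6 CONJUNCT** (read on the tower geometry):
`B6BlockParam (towerBlockOfRecord …) ↔ Prop26Printed (kGeoU ∘ val) (GU ∘ val)`. [cite: Balaban1984PropagatorsII, Prop. 2.6 (2.136)–(2.141) p.247, pp.223–250] -/
theorem b6BlockParam_tower_iff (hd1 : 1 ≤ d) (hℓ : 1 ≤ ℓ) (hb₀ : 0 < b₀) (hb₁ : b₀ ≤ b₁) {δ₀ : ℝ} (hδ₀ : 0 < δ₀)
    (hδL : δ₀ ≤ 2 / ((ℓ : ℝ) + 1)) :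
    B6BlockParam (towerBlockOfRecord d ℓ hd hL b₀ b₁ δ₀
      (fun t : TreeIdx (d + 1) (ℓ + 1) => carrier (ℓ + 1) t.1 (q1Of (ℓ + 1) t.1))
      (fun t : TSIdx d (ℓ + 1) hd hL b₀ b₁ => t.locTS)) ↔
    Prop26Printed (fun i : KRIdx d ℓ hd hL b₀ b₁ => kGeoU i.1) (fun i => GU i.1) := by
  constructor
  · rintro ⟨-, -, -, -, -, h26, -⟩
    exact h26
  · intro h26
    exact ⟨lemma21Param_tower hℓ hδ₀ hδL _ _, prop22_tower hℓ, prop23_tower d ℓ hd hL b₀ b₁ hℓ, lemma24_towerTrees hd1,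
      prop25Printed_TS (d := d) (L := ℓ + 1) (hd := hd) (hL := hL) hb₀ hb₁, h26, prop27_tower d ℓ hd hL hb₀ hb₁,
      cor28_tower d ℓ hd hL hb₀ hb₁⟩

/-! ## §5  Non-vacuity of the index of record -/

/-- **weights scale with `c_f`**: `w` is in the band (2.16) at `c_f = 1` iff `c_f²·w` is at `c_f` (`c_f ≠ 0`). [cite: Balaban1984PropagatorsII, (2.16) p.225, bookkeeping] -/
theorem globalBand_rescale {m K : ℕ} {Dm : B6SectADomainsV1.Domains (PV d ℓ m K hd hL)} {cf : ℝ} (hcf : cf ≠ 0)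
    {w : BondIdx Dm → ℝ} (hw : GlobalBand b₀ b₁ 1 w) : GlobalBand b₀ b₁ cf (fun i => cf ^ 2 * w i) := by
  intro i
  obtain ⟨h1, h2⟩ := hw i
  have key : cf ^ 2 * w i / (cf / (((ℓ + 1 : ℕ) : ℝ)) ^ (i.1.1 : ℕ)) ^ 2 = w i / (1 / (((ℓ + 1 : ℕ) : ℝ)) ^ (i.1.1 : ℕ)) ^ 2 := by
    field_simp
  rw [key]
  exact ⟨h1, h2⟩

/-- **THE INDEX OF RECORD IS INHABITED** (`L = 5`, i.e. `ℓ = 4`): for every `k ≥ 2`, every real threshold `M₂` and natural `N₁`, every band `0 < b₀ ≤ b₁`,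
a member of `KRIdx d 4 …` with `k` levels, `M₂ ≤ M = L·M_h` and `N₁ + 1 ≤ R·L·M_h` — r03's witness `kLevelFamily_nonvacuous_L5` (blocks at both top levels)
with its weights rescaled to `c_f = 5^k`. [cite: Balaban1984PropagatorsII, (2.1)–(2.4) p.224, (2.16) p.225, Prop. 2.2 p.234 («M is sufficiently large»)] -/
theorem kRIdx_nonvacuous_L5 (d k : ℕ) (hd : 1 ≤ d + 1) (hL : Odd (4 + 1) ∧ 1 < 4 + 1) (hk : 2 ≤ k) (M₂ : ℝ) (N₁ : ℕ)
    {b₀ b₁ : ℝ} (hb₀ : 0 < b₀) (hb₁ : b₀ ≤ b₁) :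
    ∃ i : KRIdx d 4 hd hL b₀ b₁, i.1.k = k ∧ M₂ ≤ (kGeoU i.1).M ∧ N₁ + 1 ≤ i.1.R * ((4 + 1) * i.1.Mh) := by
  obtain ⟨m, K, Mh, R, a, P', hN, D, hk', w, hMha, hM8, hR2, hP5, -, hpl, hM₂, hN₁, hw, hwb, -, -⟩ :=
    kLevelFamily_nonvacuous_L5 d k hd hL hk M₂ N₁ hb₀ hb₁
  have hcf : (((4 + 1 : ℕ) : ℝ)) ^ k ≠ 0 := by positivity
  refine ⟨⟨⟨m, K, Mh, k, R, a, P', hN, D, hk', hk, hMha, hM8, hR2, hP5, le_rfl, hpl, (((4 + 1 : ℕ) : ℝ)) ^ k, hcf,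
    fun i => ((((4 + 1 : ℕ) : ℝ)) ^ k) ^ 2 * w i, fun i => mul_pos (by positivity) (hw i), globalBand_rescale hcf hwb⟩, rfl⟩,
    rfl, ?_, hN₁⟩
  show M₂ ≤ (((4 + 1 : ℕ) : ℝ)) * (Mh : ℝ)
  refine hM₂.trans (le_of_eq ?_)
  push_cast; ring

end Literature.MathematicalPhysics.QuantumFieldTheory.Balaban1983to89.Node00

end
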